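import Literature.Barriers.BirchSwinnertonDyer.RankNotSumOfLocalInvariantsF4TwistPoints
import Literature.Barriers.BirchSwinnertonDyer.RankNotSumOfLocalInvariantsTwistDyadic
import Literature.NumberTheory.EllipticCurves.TwoDescentCharSum
import Literature.NumberTheory.EllipticCurves.Curve24A1Descent
import HarnessLib

/-!
# `rk E(F₄)` for `E = 480a1`, VIII: the twist `E^{(-1)}` has rank `0` over `ℚ` (complete `2`-descent)

One of the six Selmer-sharp upper bounds to which the descent leaf `rk E(F₄) = 6` of
Dokchitser–Dokchitser 2011 (proof of Thm. 2, `E = 480a1`, `F₄ = ℚ(√-1, √41, √73)`) is reduced in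
`RankNotSumOfLocalInvariantsF4TwistsQ.lean` (hypothesis `hUm1`):

* `mordellWeilRank_twist_neg1_eq_zero : (curve480a1.quadraticTwist (-1)).mordellWeilRank = 0`,

i.e. `E^{(-1)} : y² = x³ + x² - 6x = x (x - 2)(x + 3)` has Mordell–Weil rank `0`. PROVED by the
complete `2`-descent (Silverman AEC Prop. X.1.4) in the linear form: the character
`ψ = (sign, v₂, v₃, v₅)(x) ⊕ (sign, v₂, v₃, v₅)(x - 2) : E(ℚ) → 𝔽₂⁸` of the descent pair
`δ = (x, x - 2)` has kernel in `2E(ℚ)` (a class in `ℚ(S, 2)`, `S = {2, 3, 5}`, with trivial sign and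
parities is trivial; parities outside `S` vanish by the tree's `even_padicValRat_sub`), and its
image lies in the `4`-element solution set `T` of the eight linear local conditions
(`∞`: `sign x = sign (x - 2)`; `2`: the three conditions of
`dyadic_conditions_of_mod_eight_eq_seven` (`d = -1`); `3` and `5`: the two conditions each of
`local_conditions_of_mult`), the residue characters being expressed in the sign/parity
coordinates by `char_sqClass_eq_sum`. The tree's counting lemma
`pow_finrank_add_two_le_natCard_range` (`#E(ℚ)/2E(ℚ) = 2^{r+2}`, Mordell–Weil) gives
`2^{r+2} ≤ 4`. The general step is isolated as `mordellWeilRank_le_of_range_subset` and the sign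
condition as `signBit_eq_of_neg` (for all `E^{(d)}`, `d < 0`).

## References

* T. Dokchitser, V. Dokchitser, *A note on the Mordell–Weil rank modulo `n`*, J. Number Theory
  131 (2011) 1833–1839, arXiv:0910.4588, proof of Thm. 2. [DokchitserDokchitser2011RankModN]
* J. H. Silverman, *The Arithmetic of Elliptic Curves*, 2nd ed., GTM 106 (2009), Prop. X.1.4,
  Example X.1.5, Thm. VIII.6.7. [SilvermanAEC2009]
-/

noncomputable section

open scoped Classical

open WeierstrassCurve WeierstrassCurve.Affine WeierstrassCurve.Affine.Point

namespace Literature.Barriers.BirchSwinnertonDyer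

namespace DokchitserDokchitser2011

open Literature.NumberTheory.EllipticCurves
open Literature.NumberTheory.EllipticCurves.KramerTwoDescent
open Literature.NumberTheory.EllipticCurves.TwoDescentLocal

/-! ### Counting: from a finite target set to a rank bound -/

/-- **Rank bounds from the `2`-descent, counting step.** Over a number field `K`, let `E` be an
elliptic curve, `ψ : E(K) → V` additive with kernel inside `2E(K)`, `t₁, t₂` torsion points which
`ψ` separates from `0` and from each other (with `ψ (t₁ + t₂) ≠ 0`), and `T` a finite set
containing every value of `ψ`. If `#T ≤ 2^{r+2}` then `rk E(K) ≤ r` — the tree's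
`pow_finrank_add_two_le_natCard_range` (`#E(K)/2E(K) = 2^{rank} · #E(K)[2]`, Silverman AEC
VIII.§1 / X.1) with the Mordell–Weil theorem `module_finite_point_holds`.
[cite: SilvermanAEC2009, Prop. X.1.4] -/
theorem mordellWeilRank_le_of_range_subset {K : Type*} [Field K] [NumberField K]
    {W : WeierstrassCurve K} [W.IsElliptic] {V : Type*} [AddCommGroup V]
    (ψ : W.toAffine.Point →+ V) (hker : ∀ a, ψ a = 0 → ∃ b, a = 2 • b)
    {t₁ t₂ : W.toAffine.Point} (ht₁ : IsOfFinAddOrder t₁) (ht₂ : IsOfFinAddOrder t₂)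
    (h₁ : ψ t₁ ≠ 0) (h₂ : ψ t₂ ≠ 0) (h₃ : ψ (t₁ + t₂) ≠ 0) (h₁₂ : ψ t₁ ≠ ψ t₂)
    (T : Finset V) (hsub : ∀ P, ψ P ∈ T) {r : ℕ} (hT : T.card ≤ 2 ^ (r + 2)) :
    W.mordellWeilRank ≤ r := by
  haveI : Module.Finite ℤ W.toAffine.Point := W.module_finite_point_holds
  have hrange : (ψ.range : Set V) ⊆ ↑T := by
    rintro _ ⟨P, rfl⟩
    exact hsub P
  haveI : Finite ψ.range := (T.finite_toSet.subset hrange).to_subtype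
  have hcard : Nat.card ψ.range ≤ T.card := by
    rw [← SetLike.coe_sort_coe, Nat.card_coe_set_eq, ← Set.ncard_coe_finset T]
    exact Set.ncard_le_ncard hrange T.finite_toSet
  have hbound := pow_finrank_add_two_le_natCard_range ψ hker ht₁ ht₂ h₁ h₂ h₃ h₁₂
  have hle : 2 ^ (Module.finrank ℤ W.toAffine.Point + 2) ≤ 2 ^ (r + 2) :=
    hbound.trans (hcard.trans hT)
  have := (Nat.pow_le_pow_iff_right (by norm_num)).mp hle
  unfold WeierstrassCurve.mordellWeilRank
  omega

/-! ### The real place: signs on `E^{(d)}`, `d < 0` -/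

/-- **The condition at `∞` on `E^{(d)} : y² = x (x + 2d)(x - 3d)`, `d < 0`** (`3d < 0 < -2d`):
for a rational point with `y ≠ 0`, `x` and `x + 2d` have the same sign. [folklore] -/
theorem signBit_eq_of_neg {d : ℤ} (hd : d < 0) {x y : ℚ} (hy : y ≠ 0)
    (h : y ^ 2 = x * (x + 2 * d) * (x - 3 * d)) : signBit x = signBit (x + 2 * d) := by
  have hd' : (d : ℚ) < 0 := by exact_mod_cast hd
  have hpos : 0 < x * (x + 2 * d) * (x - 3 * d) := by rw [← h]; positivity
  rw [signBit, signBit]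
  by_cases hx : x < 0
  · have h2 : x + 2 * d < 0 := by linarith
    rw [if_pos hx, if_pos h2]
  · rw [if_neg hx]
    have hx0 : 0 ≤ x := not_lt.mp hx
    have h3 : 0 < x - 3 * d := by linarith
    by_cases h2 : x + 2 * d < 0
    · exfalso
      have : x * (x + 2 * d) * (x - 3 * d) ≤ 0 :=
        mul_nonpos_of_nonpos_of_nonneg (mul_nonpos_of_nonneg_of_nonpos hx0 h2.le) h3.le
      linarith
    · rw [if_neg h2]

/-! ### Residue characters in sign/parity coordinates -/

/-- The sum of `char_sqClass_eq_sum` for the tree's named characters, in terms of their values.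
[folklore] -/
theorem char_eq_sum_values (χ : Additive (SqUnits ℚ) →+ ZMod 2) (f : ℚ → ZMod 2)
    (hf : ∀ a : ℚ, a ≠ 0 → χ (Additive.ofMul (sqClass a)) = f a) (S : Finset ℕ)
    (hS : ∀ q ∈ S, q.Prime) {z : ℚ} (hz : z ≠ 0)
    (h : ∀ q : ℕ, q.Prime → q ∉ S → Even (padicValRat q z)) :
    f z = signBit z * f (-1) + ∑ p ∈ S, parityBit p z * f p := by
  rw [← hf z hz, ← hf (-1) (by norm_num), char_sqClass_eq_sum χ S hS hz h]
  congr 1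
  exact Finset.sum_congr rfl fun p hp => by rw [hf p (Nat.cast_ne_zero.mpr (hS p hp).ne_zero)]

/-- The primes `{2, 3, 5}`. [folklore] -/
theorem primes_235 : ∀ q ∈ ({2, 3, 5} : Finset ℕ), q.Prime := by decide

/-- `chi4` in coordinates for an `{2,3,5}`-supported class: `chi4 z = sign + v₃`. [folklore] -/
theorem chi4_eq_of_support {z : ℚ} (hz : z ≠ 0)
    (h : ∀ q : ℕ, q.Prime → q ∉ ({2, 3, 5} : Finset ℕ) → Even (padicValRat q z)) :
    chi4 z = signBit z + parityBit 3 z := by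
  have key := char_eq_sum_values chi4Hom chi4 (fun a ha => chi4Hom_sqClass ha) _ primes_235 hz h
  obtain ⟨h1, h2, h3, h5, -, -⟩ := chi4_values
  rw [key, Finset.sum_insert (by decide), Finset.sum_insert (by decide), Finset.sum_singleton]
  push_cast
  rw [h1, h2, h3, h5]
  ring

/-- `chi8` in coordinates for an `{2,3,5}`-supported class: `chi8 z = v₃ + v₅`. [folklore] -/
theorem chi8_eq_of_support {z : ℚ} (hz : z ≠ 0)
    (h : ∀ q : ℕ, q.Prime → q ∉ ({2, 3, 5} : Finset ℕ) → Even (padicValRat q z)) :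
    chi8 z = parityBit 3 z + parityBit 5 z := by
  have key := char_eq_sum_values chi8Hom chi8 (fun a ha => chi8Hom_sqClass ha) _ primes_235 hz h
  obtain ⟨h1, h2, h3, h5, -, -⟩ := chi8_values
  rw [key, Finset.sum_insert (by decide), Finset.sum_insert (by decide), Finset.sum_singleton]
  push_cast
  rw [h1, h2, h3, h5]
  ring

/-- `qrBit 3` in coordinates for an `{2,3,5}`-supported class: `qrBit 3 z = sign + v₂ + v₅`.
[folklore] -/
theorem qrBit_three_eq_of_support {z : ℚ} (hz : z ≠ 0)
    (h : ∀ q : ℕ, q.Prime → q ∉ ({2, 3, 5} : Finset ℕ) → Even (padicValRat q z)) :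
    qrBit 3 z = signBit z + parityBit 2 z + parityBit 5 z := by
  have key := char_eq_sum_values (qrHom 3) (qrBit 3) (fun a ha => qrHom_sqClass 3 ha) _
    primes_235 hz h
  obtain ⟨h1, h2, h3, h5, -, -⟩ := qrBit_three_values
  rw [key, Finset.sum_insert (by decide), Finset.sum_insert (by decide), Finset.sum_singleton]
  push_cast
  rw [h1, h2, h3, h5]
  ring

/-- `qrBit 5` in coordinates for an `{2,3,5}`-supported class: `qrBit 5 z = v₂ + v₃`. [folklore] -/
theorem qrBit_five_eq_of_support {z : ℚ} (hz : z ≠ 0)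
    (h : ∀ q : ℕ, q.Prime → q ∉ ({2, 3, 5} : Finset ℕ) → Even (padicValRat q z)) :
    qrBit 5 z = parityBit 2 z + parityBit 3 z := by
  have key := char_eq_sum_values (qrHom 5) (qrBit 5) (fun a ha => qrHom_sqClass 5 ha) _
    primes_235 hz h
  obtain ⟨h1, h2, h3, h5, -, -⟩ := qrBit_five_values
  rw [key, Finset.sum_insert (by decide), Finset.sum_insert (by decide), Finset.sum_singleton]
  push_cast
  rw [h1, h2, h3, h5]
  ring

/-! ### The curve `E^{(-1)} : y² = x (x - 2)(x + 3)` and its coordinates character -/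

/-- `E^{(-1)}` is an elliptic curve. [folklore] -/
instance isElliptic_twist_neg1' : (curve480a1.quadraticTwist (-1)).IsElliptic :=
  isElliptic_twist (by norm_num)

/-- Rational `2`-torsion `0, 2, -3` of `E^{(-1)} : y² = x (x - 2)(x + 3)`. [folklore] -/
theorem splitTwoTorsion_neg1 :
    (curve480a1.quadraticTwist (-1)).toAffine.SplitTwoTorsion 0 2 (-3) := by
  have h := splitTwoTorsion_twist (-1)
  norm_num at h
  exact h

/-- The equation of `E^{(-1)}` in product form. [folklore] -/
theorem equation_neg1 {x y : ℚ} (hP : (curve480a1.quadraticTwist (-1)).toAffine.Nonsingular x y) :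
    y ^ 2 = x * (x - 2) * (x + 3) := by
  have h := (twist_nonsingular_iff (by norm_num : (-1 : ℚ) ≠ 0) x y).mp hP
  rw [h]; ring

/-- On `E^{(-1)}`, `y = 0` forces `x ∈ {0, 2, -3}`. [folklore] -/
theorem x_eq_of_y_eq_zero_neg1 {x : ℚ}
    (hP : (curve480a1.quadraticTwist (-1)).toAffine.Nonsingular x 0) : x = 0 ∨ x = 2 ∨ x = -3 := by
  have h := equation_neg1 hP
  rw [zero_pow two_ne_zero, zero_eq_mul, mul_eq_zero] at h
  rcases h with (h | h) | h
  · exact Or.inl h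
  · exact Or.inr (Or.inl (by linarith))
  · exact Or.inr (Or.inr (by linarith))

/-- The coordinate space `𝔽₂⁴ × 𝔽₂⁴` of `(sign, v₂, v₃, v₅)` of the two descent components.
[folklore] -/
abbrev V8 : Type := (ZMod 2 × ZMod 2 × ZMod 2 × ZMod 2) × (ZMod 2 × ZMod 2 × ZMod 2 × ZMod 2)

/-- The sign/parity coordinates of a rational. [folklore] -/
def coordOf (z : ℚ) : ZMod 2 × ZMod 2 × ZMod 2 × ZMod 2 :=
  (signBit z, parityBit 2 z, parityBit 3 z, parityBit 5 z)

section Coords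

variable [DecidableEq ℚ]

/-- **The coordinates character** `ψ = (sign, v₂, v₃, v₅) ∘ δ₁ ⊕ (sign, v₂, v₃, v₅) ∘ δ₂` of
`E^{(-1)}(ℚ)`. [folklore] -/
def ψNeg1 : GHom (curve480a1.quadraticTwist (-1)).toAffine.Point V8 :=
  ((charFst splitTwoTorsion_neg1 signHom).prod ((charFst splitTwoTorsion_neg1 (parityHom 2)).prod
    ((charFst splitTwoTorsion_neg1 (parityHom 3)).prod (charFst splitTwoTorsion_neg1 (parityHom 5))))).prod
  ((charSnd splitTwoTorsion_neg1 signHom).prod ((charSnd splitTwoTorsion_neg1 (parityHom 2)).prod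
    ((charSnd splitTwoTorsion_neg1 (parityHom 3)).prod (charSnd splitTwoTorsion_neg1 (parityHom 5)))))

/-- `ψ` on a point with `x ≠ 0, 2`: the coordinates of `x` and `x - 2`. [folklore] -/
theorem ψNeg1_some {x y : ℚ} (hP : (curve480a1.quadraticTwist (-1)).toAffine.Nonsingular x y)
    (hx₁ : x ≠ 0) (hx₂ : x ≠ 2) : ψNeg1 (.some x y hP) = (coordOf x, coordOf (x - 2)) := by
  have hx₂' : x - 2 ≠ 0 := sub_ne_zero.mpr hx₂
  simp only [ψNeg1, AddMonoidHom.prod_apply, charFst_apply, charSnd_apply,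
    twoDescentComponent_some_of_ne hP hx₁, twoDescentComponent_some_of_ne hP hx₂, sub_zero,
    signHom_sqClass hx₁, parityHom_sqClass hx₁, signHom_sqClass hx₂', parityHom_sqClass hx₂', coordOf]

/-- `ψ` at the points with `x = 0` (`T₁`): `((1,1,1,0), (1,1,0,0))` (`δ = ([-6], [-2])`).
[folklore] -/
theorem ψNeg1_x0 {y : ℚ} (hP : (curve480a1.quadraticTwist (-1)).toAffine.Nonsingular 0 y) :
    ψNeg1 (.some _ _ hP) =
    (((1 : ZMod 2), (1 : ZMod 2), (1 : ZMod 2), (0 : ZMod 2)),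
      ((1 : ZMod 2), (1 : ZMod 2), (0 : ZMod 2), (0 : ZMod 2))) := by
  have hx : ((0 : ℚ) - 2) * (0 - -3) ≠ 0 := by norm_num
  have hx' : (0 : ℚ) - 2 ≠ 0 := by norm_num
  simp only [ψNeg1, AddMonoidHom.prod_apply, charFst_apply, charSnd_apply,
    twoDescentComponent_some_of_eq hP rfl,
    twoDescentComponent_some_of_ne hP (show (0 : ℚ) ≠ 2 by norm_num),
    signHom_sqClass hx, parityHom_sqClass hx, signHom_sqClass hx', parityHom_sqClass hx']
  refine Prod.ext (Prod.ext (signBit_of_neg (by norm_num)) (Prod.ext ?_ (Prod.ext ?_ ?_)))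
    (Prod.ext (signBit_of_neg (by norm_num)) (Prod.ext ?_ (Prod.ext ?_ ?_)))
  · exact parityBit_eq_of_eq 2 1 (u := 3) (v := 1) (-1) (Or.inr rfl) (by norm_num) (by norm_num)
      (by norm_num)
  · exact parityBit_eq_of_eq 3 1 (u := 2) (v := 1) (-1) (Or.inr rfl) (by norm_num) (by norm_num)
      (by norm_num)
  · exact parityBit_eq_of_eq 5 0 (u := 6) (v := 1) (-1) (Or.inr rfl) (by norm_num) (by norm_num)
      (by norm_num)
  · exact parityBit_eq_of_eq 2 1 (u := 1) (v := 1) (-1) (Or.inr rfl) (by norm_num) (by norm_num)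
      (by norm_num)
  · exact parityBit_eq_of_eq 3 0 (u := 2) (v := 1) (-1) (Or.inr rfl) (by norm_num) (by norm_num)
      (by norm_num)
  · exact parityBit_eq_of_eq 5 0 (u := 2) (v := 1) (-1) (Or.inr rfl) (by norm_num) (by norm_num)
      (by norm_num)

/-- `ψ` at the points with `x = 2` (`T₂`): `((0,1,0,0), (0,1,0,1))` (`δ = ([2], [10])`).
[folklore] -/
theorem ψNeg1_x2 {y : ℚ} (hP : (curve480a1.quadraticTwist (-1)).toAffine.Nonsingular 2 y) :
    ψNeg1 (.some _ _ hP) =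
    (((0 : ZMod 2), (1 : ZMod 2), (0 : ZMod 2), (0 : ZMod 2)),
      ((0 : ZMod 2), (1 : ZMod 2), (0 : ZMod 2), (1 : ZMod 2))) := by
  have hx : (2 : ℚ) - 0 ≠ 0 := by norm_num
  have hx' : ((2 : ℚ) - 0) * (2 - -3) ≠ 0 := by norm_num
  simp only [ψNeg1, AddMonoidHom.prod_apply, charFst_apply, charSnd_apply,
    twoDescentComponent_some_of_ne hP (show (2 : ℚ) ≠ 0 by norm_num),
    twoDescentComponent_some_of_eq hP rfl,
    signHom_sqClass hx, parityHom_sqClass hx, signHom_sqClass hx', parityHom_sqClass hx']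
  refine Prod.ext (Prod.ext (signBit_of_nonneg (by norm_num)) (Prod.ext ?_ (Prod.ext ?_ ?_)))
    (Prod.ext (signBit_of_nonneg (by norm_num)) (Prod.ext ?_ (Prod.ext ?_ ?_)))
  · exact parityBit_eq_of_eq 2 1 (u := 1) (v := 1) 1 (Or.inl rfl) (by norm_num) (by norm_num)
      (by norm_num)
  · exact parityBit_eq_of_eq 3 0 (u := 2) (v := 1) 1 (Or.inl rfl) (by norm_num) (by norm_num)
      (by norm_num)
  · exact parityBit_eq_of_eq 5 0 (u := 2) (v := 1) 1 (Or.inl rfl) (by norm_num) (by norm_num)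
      (by norm_num)
  · exact parityBit_eq_of_eq 2 1 (u := 5) (v := 1) 1 (Or.inl rfl) (by norm_num) (by norm_num)
      (by norm_num)
  · exact parityBit_eq_of_eq 3 0 (u := 10) (v := 1) 1 (Or.inl rfl) (by norm_num) (by norm_num)
      (by norm_num)
  · exact parityBit_eq_of_eq 5 1 (u := 2) (v := 1) 1 (Or.inl rfl) (by norm_num) (by norm_num)
      (by norm_num)

end Coords

/-- The eight linear local conditions on the coordinates (`∞`; `2` ×3; `3` ×2; `5` ×2).
[folklore] -/
def CNeg1 (w : V8) : Prop :=
  w.1.1 = w.2.1 ∧ w.1.2.1 = w.2.2.1 ∧ w.1.1 + w.1.2.2.1 = 0 ∧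
    w.2.2.2.1 + w.2.2.2.2 = w.1.2.2.1 + w.1.2.2.2 + w.1.2.1 ∧
    w.2.2.2.1 = 0 ∧ w.2.1 + w.2.2.1 + w.2.2.2.2 = 0 ∧
    w.1.2.2.2 = 0 ∧ w.1.2.1 + w.1.2.2.1 = w.2.2.2.2

/-- `CNeg1` is decidable (linear conditions over `𝔽₂`). [folklore] -/
instance decCNeg1 : DecidablePred CNeg1 := fun w => by
  unfold CNeg1; exact inferInstance

/-- The solution set `T` of the local conditions: `4` of the `256` coordinate vectors. [folklore] -/
def TNeg1 : Finset V8 := Finset.univ.filter fun w => CNeg1 w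

/-- `#T = 4`. [folklore] -/
theorem card_TNeg1 : TNeg1.card = 4 := by decide

/-- **The local conditions hold for every rational point of `E^{(-1)}` with `y ≠ 0`.** For
`P = (x, y)`: the coordinates `(sign, v₂, v₃, v₅)` of `x` and of `x - 2` satisfy `CNeg1`, by the
condition at `∞` (`signBit_eq_of_neg`), the dyadic conditions
(`dyadic_conditions_of_mod_eight_eq_seven`, `d = -1`), the conditions at `3` and `5`
(`local_conditions_of_mult`), with the residue characters rewritten in coordinates
(`chi4_eq_of_support`, …; the parities at the primes `> 5` vanish by `even_padicValRat_sub`).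
[cite: SilvermanAEC2009, Prop. X.1.4] -/
theorem cNeg1_coordOf {x y : ℚ} (hP : (curve480a1.quadraticTwist (-1)).toAffine.Nonsingular x y)
    (hy : y ≠ 0) : CNeg1 (coordOf x, coordOf (x - 2)) := by
  have h := equation_neg1 hP
  have h₀ : x * (x - 2) * (x + 3) ≠ 0 := h ▸ pow_ne_zero 2 hy
  have hx : x ≠ 0 := fun h0 => h₀ (by rw [h0, zero_mul, zero_mul])
  have hx₂ : x - 2 ≠ 0 := fun h0 => h₀ (by rw [h0, mul_zero, zero_mul])
  -- parities outside `{2, 3, 5}`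
  have hE₁ : y ^ 2 = (x - 0) * (x - 2) * (x - (-3)) := by rw [h]; ring
  have hE₂ : y ^ 2 = (x - 2) * (x - 0) * (x - (-3)) := by rw [h]; ring
  have P₁ : ∀ q : ℕ, q.Prime → q ∉ ({2, 3, 5} : Finset ℕ) → Even (padicValRat q x) := by
    intro q hq hqS
    haveI := Fact.mk hq
    simp only [Finset.mem_insert, Finset.mem_singleton, not_or] at hqS
    have := Curve24A1.even_padicValRat_sub q (by norm_num) (by norm_num) ?_ ?_ hy hE₁
    · rwa [sub_zero] at this
    · rw [show (0 : ℚ) - 2 = -((2 : ℕ) : ℚ) by norm_num, padicValRat.neg, padicValRat.of_nat,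
        padicValNat_primes hqS.1, Nat.cast_zero]
    · rw [show (0 : ℚ) - -3 = ((3 : ℕ) : ℚ) by norm_num, padicValRat.of_nat,
        padicValNat_primes hqS.2.1, Nat.cast_zero]
  have P₂ : ∀ q : ℕ, q.Prime → q ∉ ({2, 3, 5} : Finset ℕ) → Even (padicValRat q (x - 2)) := by
    intro q hq hqS
    haveI := Fact.mk hq
    simp only [Finset.mem_insert, Finset.mem_singleton, not_or] at hqS
    refine Curve24A1.even_padicValRat_sub q (by norm_num) (by norm_num) ?_ ?_ hy hE₂
    · rw [show (2 : ℚ) - 0 = ((2 : ℕ) : ℚ) by norm_num, padicValRat.of_nat,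
        padicValNat_primes hqS.1, Nat.cast_zero]
    · rw [show (2 : ℚ) - -3 = ((5 : ℕ) : ℚ) by norm_num, padicValRat.of_nat,
        padicValNat_primes hqS.2.2, Nat.cast_zero]
  -- the residue characters in coordinates
  have c4 := chi4_eq_of_support hx P₁
  have c8₁ := chi8_eq_of_support hx P₁
  have c8₂ := chi8_eq_of_support hx₂ P₂
  have q3₂ := qrBit_three_eq_of_support hx₂ P₂
  have q5₁ := qrBit_five_eq_of_support hx P₁
  -- the local conditions
  have hd : ((-1 : ℤ)) % 8 = 7 := by decide
  have hdy : y ^ 2 = x * (x + 2 * ((-1 : ℤ) : ℚ)) * (x - 3 * ((-1 : ℤ) : ℚ)) := by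
    rw [h]; push_cast; ring
  obtain ⟨d1, d2, d3⟩ := dyadic_conditions_of_mod_eight_eq_seven hd hy hdy
  have hsgn := signBit_eq_of_neg (show (-1 : ℤ) < 0 by decide) hy hdy
  have e2 : x + 2 * ((-1 : ℤ) : ℚ) = x - 2 := by push_cast; ring
  rw [e2] at d1 d3 hsgn
  -- at `3`, with the roles `e₁ = 2`, `e₂ = 0`, `e₃ = -3`
  have h3 := local_conditions_of_mult (p := 3) (e₁ := 2) (e₂ := 0) (e₃ := -3) (by decide) (by decide)
    (by rw [show ((0 : ℤ) : ℚ) - ((-3 : ℤ) : ℚ) = ((3 : ℕ) : ℚ) by norm_num, padicValRat.self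
      (by norm_num)]) hy (by rw [h]; push_cast; ring)
  -- at `5`, with `e₁ = 0`, `e₂ = 2`, `e₃ = -3`
  have h5 := local_conditions_of_mult (p := 5) (e₁ := 0) (e₂ := 2) (e₃ := -3) (by decide) (by decide)
    (by rw [show ((2 : ℤ) : ℚ) - ((-3 : ℤ) : ℚ) = ((5 : ℕ) : ℚ) by norm_num, padicValRat.self
      (by norm_num)]) hy (by rw [h]; push_cast; ring)
  obtain ⟨h3a, h3b⟩ := h3
  obtain ⟨h5a, h5b⟩ := h5
  simp only [Int.cast_zero, Int.cast_ofNat, sub_zero] at h3a h3b h5a h5b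
  have q32 : qrBit 3 ((0 : ℚ) - 2) = 0 := by
    rw [show (0 : ℚ) - 2 = ((-2 : ℤ) : ℚ) by norm_num]
    exact qrBit_eq_zero_of_isSquare (by
      rw [res_of_eq_zero 3 (padicValRat_intCast_eq_zero (by decide)), Rat.cast_intCast]
      exact ⟨1, by decide⟩)
  have q52 : qrBit 5 (2 : ℚ) = 1 := qrBit_five_values.2.1
  rw [q32, mul_zero] at h3b
  rw [q52, mul_one] at h5b
  have hb₂ : parityBit 3 (x - 2) = 0 := parityBit_eq_zero_iff.mpr h3a
  have hc₁ : parityBit 5 x = 0 := parityBit_eq_zero_iff.mpr h5a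
  -- assemble
  simp only [CNeg1, coordOf]
  refine ⟨hsgn, d1, ?_, ?_, hb₂, ?_, hc₁, ?_⟩
  · rw [← c4]; exact d2
  · rw [← c8₂, d3, c8₁]
  · rw [← q3₂]; exact h3b
  · rw [← q5₁]; exact h5b

/-- **`E^{(-1)} : y² = x³ + x² - 6x` has Mordell–Weil rank `0` over `ℚ`** — the upper bound
`hUm1` of `descent_480a1_F4_of_upper_bounds`: complete `2`-descent with the coordinates character
`ψNeg1`, whose image lies in the `4`-element set `TNeg1` (`cNeg1_coordOf` off the `2`-torsion,
direct evaluation on it) and whose kernel lies in `2E(ℚ)` (trivial signs and parities force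
trivial classes, `sqClass_eq_one_of_forall`; kernel of `δ` is `2E(ℚ)`, `ker_twoDescentMap`);
counting by `mordellWeilRank_le_of_range_subset`. (Cremona's tables: the twist of `480a1` by `-1`
has rank `0`; Dokchitser–Dokchitser: part of "2-descent shows `rk E/F₄ = 6`".)
[cite: DokchitserDokchitser2011RankModN, proof of Thm. 2] -/
theorem mordellWeilRank_twist_neg1_eq_zero : (curve480a1.quadraticTwist (-1)).mordellWeilRank = 0 := by
  letI : DecidableEq ℚ := fun a b => Classical.propDecidable (a = b)
  have h := splitTwoTorsion_neg1
  set T₁ : (curve480a1.quadraticTwist (-1)).toAffine.Point :=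
    .some _ _ (nonsingular_twoTorsion h) with hT₁
  set T₂ : (curve480a1.quadraticTwist (-1)).toAffine.Point :=
    .some _ _ (nonsingular_twoTorsion h.swap₁₂) with hT₂
  -- `ψ` on all points lands in `T`
  have hsub : ∀ P, ψNeg1 P ∈ TNeg1 := by
    intro P
    rw [TNeg1, Finset.mem_filter]
    refine ⟨Finset.mem_univ _, ?_⟩
    rcases P with _ | ⟨x, y, hP⟩
    · show CNeg1 (ψNeg1 0)
      rw [AddMonoidHom.map_zero]; decide
    · by_cases hx₁ : x = 0
      · subst hx₁
        rw [ψNeg1_x0 hP]; decide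
      by_cases hx₂ : x = 2
      · subst hx₂
        rw [ψNeg1_x2 hP]; decide
      by_cases hy : y = 0
      · subst hy
        rcases x_eq_of_y_eq_zero_neg1 hP with h0 | h2 | h3
        · exact absurd h0 hx₁
        · exact absurd h2 hx₂
        · subst h3
          rw [ψNeg1_some hP hx₁ hx₂]
          have e1 : coordOf (-3 : ℚ) = (1, 0, 1, 0) := by
            simp only [coordOf]
            refine Prod.ext (signBit_of_neg (show (-3 : ℚ) < 0 by norm_num))
              (Prod.ext ?_ (Prod.ext ?_ ?_))
            · exact parityBit_eq_of_eq 2 0 (u := 3) (v := 1) (-1) (Or.inr rfl) (by norm_num)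
                (by norm_num) (by norm_num)
            · exact parityBit_eq_of_eq 3 1 (u := 1) (v := 1) (-1) (Or.inr rfl) (by norm_num)
                (by norm_num) (by norm_num)
            · exact parityBit_eq_of_eq 5 0 (u := 3) (v := 1) (-1) (Or.inr rfl) (by norm_num)
                (by norm_num) (by norm_num)
          have e2 : coordOf ((-3 : ℚ) - 2) = (1, 0, 0, 1) := by
            simp only [coordOf]
            refine Prod.ext (signBit_of_neg (show (-3 : ℚ) - 2 < 0 by norm_num))
              (Prod.ext ?_ (Prod.ext ?_ ?_))
            · exact parityBit_eq_of_eq 2 0 (u := 5) (v := 1) (-1) (Or.inr rfl) (by norm_num)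
                (by norm_num) (by norm_num)
            · exact parityBit_eq_of_eq 3 0 (u := 5) (v := 1) (-1) (Or.inr rfl) (by norm_num)
                (by norm_num) (by norm_num)
            · exact parityBit_eq_of_eq 5 1 (u := 1) (v := 1) (-1) (Or.inr rfl) (by norm_num)
                (by norm_num) (by norm_num)
          rw [e1, e2]; decide
      · rw [ψNeg1_some hP hx₁ hx₂]
        exact cNeg1_coordOf hP hy
  -- kernel of `ψ` inside `2E(ℚ)`
  have hker : ∀ P, ψNeg1 P = 0 → ∃ Q, P = 2 • Q := by
    intro P hP0
    suffices hδ : twoDescentMap h P = 0 by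
      have hmem : P ∈ (twoDescentMap h).ker := hδ
      rw [ker_twoDescentMap h] at hmem
      obtain ⟨Q, hQ⟩ := hmem
      exact ⟨Q, hQ.symm⟩
    rcases P with _ | ⟨x, y, hP⟩
    · rfl
    · have hT : ψNeg1 (.some x y hP) ∈ TNeg1 := hsub _
      by_cases hx₁ : x = 0
      · exfalso; subst hx₁
        rw [ψNeg1_x0 hP] at hP0
        exact absurd hP0 (by decide)
      by_cases hx₂ : x = 2
      · exfalso; subst hx₂
        rw [ψNeg1_x2 hP] at hP0
        exact absurd hP0 (by decide)
      rw [ψNeg1_some hP hx₁ hx₂, Prod.mk_eq_zero] at hP0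
      obtain ⟨h1, h2⟩ := hP0
      simp only [coordOf, Prod.mk_eq_zero] at h1 h2
      have hy : y ≠ 0 := by
        rintro rfl
        rcases x_eq_of_y_eq_zero_neg1 hP with h0 | h0 | h0
        · exact hx₁ h0
        · exact hx₂ h0
        · subst h0; exact absurd h1.1 (by rw [signBit_of_neg (by norm_num)]; decide)
      have hE₁ : y ^ 2 = (x - 0) * (x - 2) * (x - (-3)) := by rw [equation_neg1 hP]; ring
      have hE₂ : y ^ 2 = (x - 2) * (x - 0) * (x - (-3)) := by rw [equation_neg1 hP]; ring
      have hx₂' : x - 2 ≠ 0 := sub_ne_zero.mpr hx₂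
      -- all parities of `x` and `x - 2` are even
      have ev₁ : ∀ q : ℕ, q.Prime → Even (padicValRat q x) := by
        intro q hq
        haveI := Fact.mk hq
        by_cases hq2 : q = 2; · subst hq2; exact parityBit_eq_zero_iff.mp h1.2.1
        by_cases hq3 : q = 3; · subst hq3; exact parityBit_eq_zero_iff.mp h1.2.2.1
        by_cases hq5 : q = 5; · subst hq5; exact parityBit_eq_zero_iff.mp h1.2.2.2
        have := Curve24A1.even_padicValRat_sub q (by norm_num) (by norm_num) ?_ ?_ hy hE₁
        · rwa [sub_zero] at this
        · rw [show (0 : ℚ) - 2 = -((2 : ℕ) : ℚ) by norm_num, padicValRat.neg, padicValRat.of_nat,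
            padicValNat_primes hq2, Nat.cast_zero]
        · rw [show (0 : ℚ) - -3 = ((3 : ℕ) : ℚ) by norm_num, padicValRat.of_nat,
            padicValNat_primes hq3, Nat.cast_zero]
      have ev₂ : ∀ q : ℕ, q.Prime → Even (padicValRat q (x - 2)) := by
        intro q hq
        haveI := Fact.mk hq
        by_cases hq2 : q = 2; · subst hq2; exact parityBit_eq_zero_iff.mp h2.2.1
        by_cases hq3 : q = 3; · subst hq3; exact parityBit_eq_zero_iff.mp h2.2.2.1
        by_cases hq5 : q = 5; · subst hq5; exact parityBit_eq_zero_iff.mp h2.2.2.2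
        refine Curve24A1.even_padicValRat_sub q (by norm_num) (by norm_num) ?_ ?_ hy hE₂
        · rw [show (2 : ℚ) - 0 = ((2 : ℕ) : ℚ) by norm_num, padicValRat.of_nat,
            padicValNat_primes hq2, Nat.cast_zero]
        · rw [show (2 : ℚ) - -3 = ((5 : ℕ) : ℚ) by norm_num, padicValRat.of_nat,
            padicValNat_primes hq5, Nat.cast_zero]
      have hpos₁ : 0 < x := (signBit_eq_zero_iff hx₁).mp h1.1
      have hpos₂ : 0 < x - 2 := (signBit_eq_zero_iff hx₂').mp h2.1
      rw [twoDescentMap_apply, twoDescentComponent_some_of_ne hP hx₁,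
        twoDescentComponent_some_of_ne hP hx₂, sub_zero, sqClass_eq_one_of_forall hx₁ hpos₁ ev₁,
        sqClass_eq_one_of_forall hx₂' hpos₂ ev₂]
      rfl
  -- torsion and values
  have hfin₁ : IsOfFinAddOrder T₁ := by
    refine isOfFinAddOrder_iff_nsmul_eq_zero.mpr ⟨2, two_pos, ?_⟩
    rw [two_nsmul, hT₁]
    exact add_self_of_Y_eq (by norm_num [negY, twoTorsionY])
  have hfin₂ : IsOfFinAddOrder T₂ := by
    refine isOfFinAddOrder_iff_nsmul_eq_zero.mpr ⟨2, two_pos, ?_⟩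
    rw [two_nsmul, hT₂]
    exact add_self_of_Y_eq (by norm_num [negY, twoTorsionY])
  have h₁ : ψNeg1 T₁ ≠ 0 := by rw [hT₁, ψNeg1_x0]; decide
  have h₂ : ψNeg1 T₂ ≠ 0 := by rw [hT₂, ψNeg1_x2]; decide
  have h₃ : ψNeg1 (T₁ + T₂) ≠ 0 := by rw [map_add, hT₁, hT₂, ψNeg1_x0, ψNeg1_x2]; decide
  have h₁₂ : ψNeg1 T₁ ≠ ψNeg1 T₂ := by rw [hT₁, hT₂, ψNeg1_x0, ψNeg1_x2]; decide
  have hle := mordellWeilRank_le_of_range_subset ψNeg1 hker hfin₁ hfin₂ h₁ h₂ h₃ h₁₂ TNeg1 hsub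
    (r := 0) (by rw [card_TNeg1]; norm_num)
  omega

end DokchitserDokchitser2011

end Literature.Barriers.BirchSwinnertonDyer

end
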